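import Mathlib.Analysis.SpecificLimits.Normed
import Mathlib.Analysis.SpecialFunctions.Log.Base
import Mathlib.Analysis.SpecialFunctions.Pow.Real
import Mathlib.Data.Nat.Choose.Bounds
import Literature.Computability.AlgebraicComplexity.SchoenhageTau
import Literature.Computability.AlgebraicComplexity.SchoenhageTauProofs
import Literature.Computability.AlgebraicComplexity.FlatteningBound
import Literature.Computability.AlgebraicComplexity.KroneckerRank
import Literature.Computability.AlgebraicComplexity.TensorRankFactsProofs
import HarnessLib

/-!
# Bini's theorem `bR(⟨k,m,n⟩) ≤ r ⇒ ω ≤ 3 log_{kmn} r` (Bläser 2013, Thm. 6.3 and Thm. 6.6) — proved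

Topic `Literature/Computability/AlgebraicComplexity`. Sibling of `SchoenhageTau.lean`, which vendors
the algebraic border rank `R_h(t)`, `bR(t) = min_h R_h(t)` over `K[ε]` (Bläser 2013, Def. 6.1) and
the named fact `Blaser2013_thm66` (Bini 1980), and of `SchoenhageTauProofs.lean`, which proves
Lemma 6.4 (`R(t) ≤ C(h+2,2) R_h(t)`, `tensorRank_le_choose_mul_approxRank`). This file DISCHARGES
`Blaser2013_thm66`, following the printed proofs (M. Bläser, *Fast Matrix Multiplication*, Theory of
Computing Graduate Surveys 5 (2013), pp. 27–28):

* **Thm. 6.3(1)** (cyclic case) `R_h(πt) = R_h(t)`: `approxRank_rotate_le`, and for matrix tensors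
  `approxRank_matMulTensor_rotate_le : R_h(⟨m,n,k⟩) ≤ R_h(⟨k,m,n⟩)`; restriction along index maps
  `approxRank_precomp_le` (the `K[ε]`-version of Lemma 5.4 for coordinate maps).
* **Thm. 6.3(3)** `R_{h+h'}(t ⊗ t') ≤ R_h(t) R_{h'}(t')`: `IsApproxDecomposition.kronecker` (the
  products `u_ρ ⊗ u'_{ρ'}` of two approximate decompositions: "`T ⊗ T' = ε^{h+h'} t ⊗ t' +
  O(ε^{h+h'+1})`", coefficientwise `coeff_mul_eq_ite_of_coeff_eq_ite`), `approxRank_kroneckerTensor_le`;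
  with "matrix tensors multiply" (`kroneckerTensor_matMulTensor`, `KroneckerRank.lean`)
  `approxRank_matMulTensor_mul_le : R_{h+h'}(⟨kk',mm',nn'⟩) ≤ R_h(⟨k,m,n⟩) R_{h'}(⟨k',m',n'⟩)`,
  whence `R_{3h}(⟨N,N,N⟩) ≤ R_h(⟨k,m,n⟩)³`, `N = kmn` (`approxRank_matMulTensor_cube_le`) and
  `R_{sh}(⟨Nˢ,Nˢ,Nˢ⟩) ≤ R_h(⟨N,N,N⟩)ˢ` (`approxRank_matMulTensor_pow_le`).
* **Thm. 6.6**: `R(⟨Nˢ,Nˢ,Nˢ⟩) ≤ C(3hs+2,2) r^{3s}` for all `s` (Lemma 6.4); since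
  `(Nˢ)^ω ≤ R(⟨Nˢ,Nˢ,Nˢ⟩)` (Thm. 5.9: `log_n R(⟨n,n,n⟩)` is an admissible exponent,
  `Blaser2013_logb_mem_admissibleExponents`), `(N^ω/r³)ˢ ≤ C(3hs+2,2) ≤ (3h+2)² s²` for all `s ≥ 1`,
  forcing `N^ω ≤ r³`, i.e. `ω ≤ 3 log_N r` (Bläser: "`ω ≤ 3 log_N r + (1/s) log_N poly(s)`, `→ 0`;
  since `ω` is an infimum, `ω ≤ 3 log_N r`") — DISCHARGE `Blaser2013_thm66_holds`.

## References

* M. Bläser, *Fast Matrix Multiplication*, Theory of Computing Library, Graduate Surveys 5 (2013),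
  1–60, doi:10.4086/toc.gs.2013.005 (held: `paper:doi-10-4086-toc-gs-2013-005`, read pp. 26–28):
  Def. 6.1, Rem. 6.2, Thm. 6.3 (p. 27), Lemma 6.4, Thm. 6.6 (p. 28). [Blaser2013]
* D. Bini, *Relations between exact and approximate bilinear algorithms. Applications*, Calcolo 17
  (1980) 87–97 (the original of Thm. 6.6; cited through Bläser 2013, [3]).

## Design notes

* `n^ω ≤ R(⟨n,n,n⟩)` exists in `TensorRestrictionRank.lean` for `K : Type` only
  (`rpow_omega_le_tensorRank_matMulTensor`); `Blaser2013_thm66` quantifies over `K : Type u`, so the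
  short derivation from `Blaser2013_logb_mem_admissibleExponents` (universe-polymorphic) is repeated
  inside the proof of `Blaser2013_thm66_holds`.
* No new definitions: the product of two approximate decompositions with `r`, `r'` triads is
  indexed by `Fin (r r')` via `finProdFinEquiv`. Thm. 6.3(2) (direct sums) is not needed here and
  not formalised.
-/

noncomputable section

open scoped BigOperators Polynomial
open Filter Topology

namespace Literature.Computability.AlgebraicComplexity

universe u v₁ v₂ v₃

/-! ## Restriction, rotation and products of approximate decompositions (Thm. 6.3) -/

section ApproxCalculus

variable {K : Type u} [CommSemiring K]
variable {ι κ μ ι' κ' μ' : Type*}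

/-- For finite index types the minimum defining `R_h(t)` is attained: there is an approximate
decomposition of order `h` with exactly `R_h(t)` triads. [cite: Blaser2013, Def. 6.1] -/
theorem exists_isApproxDecomposition_approxRank [Fintype ι] [Fintype κ] [Fintype μ] [DecidableEq ι]
    [DecidableEq κ] [DecidableEq μ] (h : ℕ) (t : ι → κ → μ → K) :
    ∃ (u : Fin (approxRank h t) → ι → K[X]) (v : Fin (approxRank h t) → κ → K[X])
      (w : Fin (approxRank h t) → μ → K[X]), IsApproxDecomposition h t u v w :=
  Nat.sInf_mem (s := {r : ℕ | ∃ (u : Fin r → ι → K[X]) (v : Fin r → κ → K[X])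
    (w : Fin r → μ → K[X]), IsApproxDecomposition h t u v w}) (exists_isApproxDecomposition h t)

/-- The minimum defining the border rank `bR(t) = min_h R_h(t)` is attained at some order `h`.
[cite: Blaser2013, Def. 6.1] -/
theorem exists_algBorderRank_eq_approxRank (t : ι → κ → μ → K) :
    ∃ h, algBorderRank t = approxRank h t := by
  obtain ⟨h, hh⟩ := Nat.sInf_mem (Set.range_nonempty fun h : ℕ => approxRank h t)
  exact ⟨h, hh.symm⟩

/-- An approximate decomposition restricts along index maps `f, g, e` (compose each vector with
the map): the `K[ε]`-version of Bläser 2013, Lemma 5.4 for coordinate maps, used in Thm. 6.3.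
[cite: Blaser2013, Thm. 6.3] -/
theorem IsApproxDecomposition.precomp {h : ℕ} {t : ι → κ → μ → K} {r : ℕ} {u : Fin r → ι → K[X]}
    {v : Fin r → κ → K[X]} {w : Fin r → μ → K[X]} (huvw : IsApproxDecomposition h t u v w)
    (f : ι' → ι) (g : κ' → κ) (e : μ' → μ) :
    IsApproxDecomposition h (fun a b c => t (f a) (g b) (e c)) (fun ρ a => u ρ (f a))
      (fun ρ b => v ρ (g b)) (fun ρ c => w ρ (e c)) :=
  fun a b c j hj => huvw (f a) (g b) (e c) j hj

/-- `R_h(t ∘ (f × g × e)) ≤ R_h(t)`: restriction along index maps does not increase the approximate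
rank (finite index types). [cite: Blaser2013, Thm. 6.3] -/
theorem approxRank_precomp_le [Fintype ι] [Fintype κ] [Fintype μ] [DecidableEq ι] [DecidableEq κ]
    [DecidableEq μ] (h : ℕ) (t : ι → κ → μ → K) (f : ι' → ι) (g : κ' → κ) (e : μ' → μ) :
    approxRank h (fun a b c => t (f a) (g b) (e c)) ≤ approxRank h t := by
  obtain ⟨u, v, w, huvw⟩ := exists_isApproxDecomposition_approxRank h t
  exact approxRank_le_of_isApproxDecomposition (huvw.precomp f g e)

/-- Rotating the factors `(u, v, w) ↦ (v, w, u)` of an approximate decomposition of `t` gives one of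
`rotate t` (Bläser 2013, Thm. 6.3(1): "`R_h(πt) = R_h(t)`. Clear."). [cite: Blaser2013, Thm. 6.3(1)] -/
theorem isApproxDecomposition_rotate {h : ℕ} {t : ι → κ → μ → K} {r : ℕ} {u : Fin r → ι → K[X]}
    {v : Fin r → κ → K[X]} {w : Fin r → μ → K[X]} (huvw : IsApproxDecomposition h t u v w) :
    IsApproxDecomposition h (rotate t) v w u := by
  intro b c a j hj
  have hs : (∑ ρ, v ρ b * w ρ c * u ρ a) = ∑ ρ, u ρ a * v ρ b * w ρ c :=
    Finset.sum_congr rfl fun ρ _ => by ring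
  rw [hs, rotate_apply]
  exact huvw a b c j hj

/-- **Thm. 6.3(1), cyclic case**: `R_h(πt) ≤ R_h(t)` for `π = (1 2 3)` (finite index types; equality
by iterating three times). [cite: Blaser2013, Thm. 6.3(1)] -/
theorem approxRank_rotate_le [Fintype ι] [Fintype κ] [Fintype μ] [DecidableEq ι] [DecidableEq κ]
    [DecidableEq μ] (h : ℕ) (t : ι → κ → μ → K) : approxRank h (rotate t) ≤ approxRank h t := by
  obtain ⟨u, v, w, huvw⟩ := exists_isApproxDecomposition_approxRank h t
  exact approxRank_le_of_isApproxDecomposition (isApproxDecomposition_rotate huvw)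

/-- If `P = ε^h x + O(ε^{h+1})` and `Q = ε^{h'} y + O(ε^{h'+1})` then `PQ = ε^{h+h'} xy + O(ε^{h+h'+1})`
(coefficientwise form; the computation in the proof of Bläser 2013, Thm. 6.3(3)).
[cite: Blaser2013, Thm. 6.3(3) (proof)] -/
theorem coeff_mul_eq_ite_of_coeff_eq_ite {P Q : K[X]} {h h' : ℕ} {x y : K}
    (hP : ∀ j ≤ h, P.coeff j = if j = h then x else 0)
    (hQ : ∀ j ≤ h', Q.coeff j = if j = h' then y else 0) (j : ℕ) (hj : j ≤ h + h') :
    (P * Q).coeff j = if j = h + h' then x * y else 0 := by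
  rw [Polynomial.coeff_mul]
  split_ifs with hjh
  · subst hjh
    rw [Finset.sum_eq_single_of_mem (h, h') (by simp)]
    · rw [hP h le_rfl, hQ h' le_rfl, if_pos rfl, if_pos rfl]
    · rintro ⟨a, b⟩ hab hne
      rw [Finset.mem_antidiagonal] at hab
      dsimp only at hab ⊢
      rcases lt_trichotomy a h with ha | rfl | ha
      · rw [hP a ha.le, if_neg ha.ne, zero_mul]
      · exact (hne (Prod.ext rfl (by simpa using hab))).elim
      · have hb : b < h' := by omega
        rw [hQ b hb.le, if_neg hb.ne, mul_zero]
  · refine Finset.sum_eq_zero ?_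
    rintro ⟨a, b⟩ hab
    rw [Finset.mem_antidiagonal] at hab
    dsimp only at hab ⊢
    rcases lt_or_ge a h with ha | ha
    · rw [hP a ha.le, if_neg ha.ne, zero_mul]
    · have hb : b < h' := by omega
      rw [hQ b hb.le, if_neg hb.ne, mul_zero]

/-- **Thm. 6.3(3), the construction**: the products `u_ρ ⊗ u'_{ρ'}` etc. of approximate
decompositions of `t` (order `h`, `r` triads) and `t'` (order `h'`, `r'` triads) form an approximate
decomposition of `t ⊗ t'` of order `h + h'` with `r r'` triads ("`T ⊗ T' = ε^{h+h'} t ⊗ t' +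
O(ε^{h+h'+1})`"). [cite: Blaser2013, Thm. 6.3(3)] -/
theorem IsApproxDecomposition.kronecker {h h' : ℕ} {t : ι → κ → μ → K} {t' : ι' → κ' → μ' → K}
    {r r' : ℕ} {u : Fin r → ι → K[X]} {v : Fin r → κ → K[X]} {w : Fin r → μ → K[X]}
    {u' : Fin r' → ι' → K[X]} {v' : Fin r' → κ' → K[X]} {w' : Fin r' → μ' → K[X]}
    (huvw : IsApproxDecomposition h t u v w) (huvw' : IsApproxDecomposition h' t' u' v' w') :
    IsApproxDecomposition (h + h') (kroneckerTensor t t')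
      (fun ρ a => u (finProdFinEquiv.symm ρ).1 a.1 * u' (finProdFinEquiv.symm ρ).2 a.2)
      (fun ρ b => v (finProdFinEquiv.symm ρ).1 b.1 * v' (finProdFinEquiv.symm ρ).2 b.2)
      (fun ρ c => w (finProdFinEquiv.symm ρ).1 c.1 * w' (finProdFinEquiv.symm ρ).2 c.2) := by
  intro a b c j hj
  have hsum : (∑ ρ : Fin (r * r'),
      u (finProdFinEquiv.symm ρ).1 a.1 * u' (finProdFinEquiv.symm ρ).2 a.2 *
        (v (finProdFinEquiv.symm ρ).1 b.1 * v' (finProdFinEquiv.symm ρ).2 b.2) *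
        (w (finProdFinEquiv.symm ρ).1 c.1 * w' (finProdFinEquiv.symm ρ).2 c.2)) =
      (∑ ρ, u ρ a.1 * v ρ b.1 * w ρ c.1) * ∑ ρ', u' ρ' a.2 * v' ρ' b.2 * w' ρ' c.2 := by
    rw [Finset.sum_mul_sum, ← Fintype.sum_prod_type']
    exact Fintype.sum_equiv finProdFinEquiv.symm _ _ fun ρ => by ring
  rw [hsum, kroneckerTensor_apply]
  exact coeff_mul_eq_ite_of_coeff_eq_ite (huvw a.1 b.1 c.1) (huvw' a.2 b.2 c.2) j hj

/-- **Bläser 2013, Thm. 6.3(3)**: `R_{h+h'}(t ⊗ t') ≤ R_h(t) · R_{h'}(t')` (finite index types).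
[cite: Blaser2013, Thm. 6.3(3)] -/
theorem approxRank_kroneckerTensor_le [Fintype ι] [Fintype κ] [Fintype μ] [DecidableEq ι]
    [DecidableEq κ] [DecidableEq μ] [Fintype ι'] [Fintype κ'] [Fintype μ'] [DecidableEq ι']
    [DecidableEq κ'] [DecidableEq μ'] (h h' : ℕ) (t : ι → κ → μ → K) (t' : ι' → κ' → μ' → K) :
    approxRank (h + h') (kroneckerTensor t t') ≤ approxRank h t * approxRank h' t' := by
  obtain ⟨u, v, w, huvw⟩ := exists_isApproxDecomposition_approxRank h t
  obtain ⟨u', v', w', huvw'⟩ := exists_isApproxDecomposition_approxRank h' t'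
  exact approxRank_le_of_isApproxDecomposition (huvw.kronecker huvw')

end ApproxCalculus

/-! ## Matrix multiplication tensors: rotation, products, cube, powers -/

section MatMul

variable (K : Type u) [CommSemiring K]

/-- **Thm. 6.3(1) for matrix tensors**: `R_h(⟨m,n,k⟩) ≤ R_h(⟨k,m,n⟩)` (rotation `⟨k,m,n⟩ ↦ ⟨m,n,k⟩`
is a relabelling of the rotated tensor, `matMulTensor_rotate`). [cite: Blaser2013, Thm. 6.3(1)] -/
theorem approxRank_matMulTensor_rotate_le (h k m n : ℕ) :
    approxRank h (matMulTensor K m n k) ≤ approxRank h (matMulTensor K k m n) := by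
  have e : matMulTensor K m n k =
      fun b c a => rotate (matMulTensor K k m n) (Prod.swap b) c (Prod.swap a) := by
    funext b c a
    rw [rotate_apply, matMulTensor_rotate K k m n b.swap c a.swap, Prod.swap_swap, Prod.swap_swap]
  rw [e]
  exact (approxRank_precomp_le h _ _ _ _).trans (approxRank_rotate_le h _)

/-- **`R_{h+h'}(⟨kk', mm', nn'⟩) ≤ R_h(⟨k,m,n⟩) · R_{h'}(⟨k',m',n'⟩)`** (Bläser 2013, Thm. 6.3(3) with
"matrix tensors multiply", p. 24). [cite: Blaser2013, Thm. 6.3(3)] -/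
theorem approxRank_matMulTensor_mul_le (h h' k m n k' m' n' : ℕ) :
    approxRank (h + h') (matMulTensor K (k * k') (m * m') (n * n')) ≤
      approxRank h (matMulTensor K k m n) * approxRank h' (matMulTensor K k' m' n') := by
  have e : matMulTensor K (k * k') (m * m') (n * n') = fun a b c =>
      kroneckerTensor (matMulTensor K k m n) (matMulTensor K k' m' n')
        ((doubleIndexEquiv k n k' n').symm a) ((doubleIndexEquiv k m k' m').symm b)
        ((doubleIndexEquiv m n m' n').symm c) := by
    funext a b c
    rw [kroneckerTensor_matMulTensor]
    simp only [Equiv.apply_symm_apply]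
  rw [e]
  exact (approxRank_precomp_le _ _ _ _ _).trans (approxRank_kroneckerTensor_le _ _ _ _)

/-- **`R_{3h}(⟨kmn, kmn, kmn⟩) ≤ R_h(⟨k,m,n⟩)³`** (Bläser 2013, proof of Thm. 6.6: "By Theorem 6.3, we
get `R_{3h}(⟨N,N,N⟩) ≤ r³`", via `⟨k,m,n⟩ ⊗ ⟨m,n,k⟩ ⊗ ⟨n,k,m⟩ ≅ ⟨N,N,N⟩`).
[cite: Blaser2013, Thm. 6.6 (proof)] -/
theorem approxRank_matMulTensor_cube_le (h k m n : ℕ) :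
    approxRank (3 * h) (matMulTensor K (k * m * n) (k * m * n) (k * m * n)) ≤
      approxRank h (matMulTensor K k m n) ^ 3 := by
  have h1 := approxRank_matMulTensor_mul_le K h h k m n m n k
  have h2 := approxRank_matMulTensor_mul_le K (h + h) h (k * m) (m * n) (n * k) n k m
  have hr1 := approxRank_matMulTensor_rotate_le K h k m n
  have hr2 := (approxRank_matMulTensor_rotate_le K h m n k).trans hr1
  have hb : m * n * k = k * m * n := by ring
  have hc : n * k * m = k * m * n := by ring
  have h3 : h + h + h = 3 * h := by ring
  rw [hb, hc, h3] at h2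
  calc approxRank (3 * h) (matMulTensor K (k * m * n) (k * m * n) (k * m * n))
      ≤ approxRank (h + h) (matMulTensor K (k * m) (m * n) (n * k)) *
          approxRank h (matMulTensor K n k m) := h2
    _ ≤ approxRank h (matMulTensor K k m n) * approxRank h (matMulTensor K m n k) *
          approxRank h (matMulTensor K n k m) := Nat.mul_le_mul_right _ h1
    _ ≤ approxRank h (matMulTensor K k m n) * approxRank h (matMulTensor K k m n) *
          approxRank h (matMulTensor K k m n) :=
        Nat.mul_le_mul (Nat.mul_le_mul_left _ hr1) hr2
    _ = approxRank h (matMulTensor K k m n) ^ 3 := by ring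

/-- **`R_{sh}(⟨Nˢ, Nˢ, Nˢ⟩) ≤ R_h(⟨N,N,N⟩)ˢ`** (Bläser 2013, proof of Thm. 6.6:
"`R_{3hs}(⟨Nˢ,Nˢ,Nˢ⟩) ≤ r^{3s}` for all `s`", iterating Thm. 6.3(3)). [cite: Blaser2013, Thm. 6.6 (proof)] -/
theorem approxRank_matMulTensor_pow_le (h N s : ℕ) :
    approxRank (s * h) (matMulTensor K (N ^ s) (N ^ s) (N ^ s)) ≤
      approxRank h (matMulTensor K N N N) ^ s := by
  induction s with
  | zero =>
    simp only [zero_mul, pow_zero, approxRank_zero]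
    simpa using tensorRank_matMulTensor_le K 1 1 1
  | succ s ih =>
    rw [pow_succ, pow_succ, Nat.succ_mul]
    exact (approxRank_matMulTensor_mul_le K (s * h) h (N ^ s) (N ^ s) (N ^ s) N N N).trans
      (Nat.mul_le_mul_right _ ih)

end MatMul

/-! ## Thm. 6.6 (Bini) -/

/-- DISCHARGE of the named fact `Blaser2013_thm66` (`SchoenhageTau.lean`) — **Bläser 2013,
Thm. 6.6** (Bini 1980): if `bR(⟨k, m, n⟩) ≤ r` (`kmn ≥ 2`, `r ≥ 1`) then `ω ≤ 3 log_{kmn} r`, over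
every field. Proof as printed (p. 28): with `N = kmn` and `R_h(⟨k,m,n⟩) = bR(⟨k,m,n⟩) ≤ r`,
Thm. 6.3 gives `R_{3hs}(⟨Nˢ,Nˢ,Nˢ⟩) ≤ r^{3s}` (`approxRank_matMulTensor_cube_le`,
`approxRank_matMulTensor_pow_le`), Lemma 6.4 (`tensorRank_le_choose_mul_approxRank`,
`SchoenhageTauProofs.lean`) gives `R(⟨Nˢ,Nˢ,Nˢ⟩) ≤ C(3hs+2,2) r^{3s}`, and
Thm. 5.9 (`(Nˢ)^ω ≤ R(⟨Nˢ,Nˢ,Nˢ⟩)`, from `Blaser2013_logb_mem_admissibleExponents`) gives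
`N^{sω} ≤ C(3hs+2,2) r^{3s}`;
as `C(3hs+2,2) ≤ (3h+2)² s²` grows polynomially, `N^ω ≤ r³`, i.e. `ω ≤ 3 log_N r`.
[cite: Blaser2013, Thm. 6.6] -/
theorem Blaser2013_thm66_holds : Blaser2013_thm66.{u} := by
  intro K _ k m n r hkmn hr hbr
  obtain ⟨h, hh⟩ := exists_algBorderRank_eq_approxRank (matMulTensor K k m n)
  rw [hh] at hbr
  -- upper bound `R(⟨Nˢ,Nˢ,Nˢ⟩) ≤ C(3hs+2,2) (r³)ˢ`
  have hrank : ∀ s : ℕ, (tensorRank (matMulTensor K ((k * m * n) ^ s) ((k * m * n) ^ s)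
      ((k * m * n) ^ s)) : ℝ) ≤ ((s * (3 * h) + 2).choose 2 : ℕ) * ((r : ℝ) ^ 3) ^ s := by
    intro s
    have h1 := tensorRank_le_choose_mul_approxRank (s * (3 * h))
      (matMulTensor K ((k * m * n) ^ s) ((k * m * n) ^ s) ((k * m * n) ^ s))
    have h2 := approxRank_matMulTensor_pow_le K (3 * h) (k * m * n) s
    have h3 := approxRank_matMulTensor_cube_le K h k m n
    have h4 : approxRank (3 * h) (matMulTensor K (k * m * n) (k * m * n) (k * m * n)) ^ s ≤
        (r ^ 3) ^ s := Nat.pow_le_pow_left (h3.trans (Nat.pow_le_pow_left hbr 3)) s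
    have h5 : tensorRank (matMulTensor K ((k * m * n) ^ s) ((k * m * n) ^ s) ((k * m * n) ^ s)) ≤
        (s * (3 * h) + 2).choose 2 * (r ^ 3) ^ s := h1.trans (Nat.mul_le_mul_left _ (h2.trans h4))
    exact_mod_cast h5
  -- `q^ω ≤ R(⟨q,q,q⟩)` for `q ≥ 2` (Thm. 5.9 with `r = R(⟨q,q,q⟩)`), over `K : Type u`
  have hpow : ∀ q : ℕ, 2 ≤ q → (q : ℝ) ^ omega K ≤ tensorRank (matMulTensor K q q q) := by
    intro q hq
    have hR1 : 1 ≤ tensorRank (matMulTensor K q q q) :=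
      (Nat.one_le_pow _ _ (by omega)).trans (matMulTensor_sq_le_tensorRank K q)
    have hq0 : (0 : ℝ) < q := by exact_mod_cast (by omega : 0 < q)
    have hq1 : (1 : ℝ) < q := by exact_mod_cast (by omega : 1 < q)
    have hR0 : (0 : ℝ) < tensorRank (matMulTensor K q q q) := by exact_mod_cast hR1
    have hω : omega K ≤ Real.logb q (tensorRank (matMulTensor K q q q)) :=
      csInf_le (admissibleExponents_bddBelow K)
        (Blaser2013_logb_mem_admissibleExponents K (by omega : 1 < q) hR1 le_rfl)
    calc (q : ℝ) ^ omega K ≤ (q : ℝ) ^ Real.logb q (tensorRank (matMulTensor K q q q)) :=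
        Real.rpow_le_rpow_of_exponent_le hq1.le hω
      _ = _ := Real.rpow_logb hq0 hq1.ne' hR0
  -- lower bound `(N^ω)ˢ ≤ R(⟨Nˢ,Nˢ,Nˢ⟩)` for `s ≥ 1`
  have hN0 : (0 : ℝ) < (k * m * n : ℕ) := by exact_mod_cast (by omega : 0 < k * m * n)
  have hN1 : (1 : ℝ) < (k * m * n : ℕ) := by exact_mod_cast (by omega : 1 < k * m * n)
  have hlow : ∀ s : ℕ, 1 ≤ s → (((k * m * n : ℕ) : ℝ) ^ omega K) ^ s ≤
      (tensorRank (matMulTensor K ((k * m * n) ^ s) ((k * m * n) ^ s) ((k * m * n) ^ s)) : ℝ) := by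
    intro s hs
    have hNs : 2 ≤ (k * m * n) ^ s :=
      hkmn.trans (by simpa using Nat.pow_le_pow_right (by omega : 0 < k * m * n) hs)
    have hl := hpow _ hNs
    have e : (((k * m * n : ℕ) : ℝ) ^ omega K) ^ s = ((((k * m * n) ^ s : ℕ) : ℝ)) ^ omega K := by
      rw [← Real.rpow_mul_natCast hN0.le, mul_comm (omega K), Real.rpow_natCast_mul hN0.le,
        Nat.cast_pow]
    rw [e]
    exact hl
  -- suppose `3 log_N r < ω`; then `x = N^ω / r³ > 1` but `xˢ ≤ (3h+2)² s²` for all `s ≥ 1`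
  by_contra hlt
  rw [not_le] at hlt
  have hr0 : (0 : ℝ) < r := by exact_mod_cast hr
  have hb0 : (0 : ℝ) < (r : ℝ) ^ 3 := pow_pos hr0 3
  have hlog : Real.logb (k * m * n : ℕ) ((r : ℝ) ^ 3) < omega K := by
    rw [Real.logb_pow]
    exact_mod_cast hlt
  have hab : (r : ℝ) ^ 3 < ((k * m * n : ℕ) : ℝ) ^ omega K := by
    have := Real.rpow_lt_rpow_of_exponent_lt hN1 hlog
    rwa [Real.rpow_logb hN0 hN1.ne' hb0] at this
  set a : ℝ := ((k * m * n : ℕ) : ℝ) ^ omega K with ha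
  have ha0 : 0 < a := Real.rpow_pos_of_pos hN0 _
  set x : ℝ := a / (r : ℝ) ^ 3 with hx
  have hx1 : 1 < x := (one_lt_div hb0).2 hab
  have hx0 : 0 < x := zero_lt_one.trans hx1
  set C : ℝ := ((3 * h + 2 : ℕ) : ℝ) ^ 2 with hC
  have hC0 : 0 < C := by positivity
  -- `xˢ ≤ C s²` for `s ≥ 1`
  have hxs : ∀ s : ℕ, 1 ≤ s → x ^ s ≤ C * (s : ℝ) ^ 2 := by
    intro s hs
    have hcs : ((s * (3 * h) + 2).choose 2 : ℕ) ≤ (s * (3 * h + 2)) ^ 2 :=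
      (Nat.choose_le_pow _ 2).trans (Nat.pow_le_pow_left (by nlinarith) 2)
    have hcs' : (((s * (3 * h) + 2).choose 2 : ℕ) : ℝ) ≤ C * (s : ℝ) ^ 2 := by
      have : (((s * (3 * h) + 2).choose 2 : ℕ) : ℝ) ≤ (((s * (3 * h + 2)) ^ 2 : ℕ) : ℝ) := by
        exact_mod_cast hcs
      refine this.trans_eq ?_
      rw [hC]
      push_cast
      ring
    have h1 : a ^ s ≤ ((s * (3 * h) + 2).choose 2 : ℕ) * ((r : ℝ) ^ 3) ^ s :=
      (hlow s hs).trans (hrank s)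
    rw [hx, div_pow, div_le_iff₀ (pow_pos hb0 s)]
    calc a ^ s ≤ ((s * (3 * h) + 2).choose 2 : ℕ) * ((r : ℝ) ^ 3) ^ s := h1
      _ ≤ C * (s : ℝ) ^ 2 * ((r : ℝ) ^ 3) ^ s :=
        mul_le_mul_of_nonneg_right hcs' (pow_nonneg hb0.le s)
  -- but `s² / xˢ → 0`
  have hlim : Tendsto (fun s : ℕ => (s : ℝ) ^ 2 / x ^ s) atTop (𝓝 0) :=
    tendsto_pow_const_div_const_pow_of_one_lt 2 hx1
  have hsmall : (0 : ℝ) < 1 / C := by positivity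
  obtain ⟨s, hs1, hs⟩ := ((eventually_ge_atTop 1).and (hlim.eventually (gt_mem_nhds hsmall))).exists
  rw [div_lt_div_iff₀ (pow_pos hx0 s) hC0, one_mul] at hs
  have h2 := hxs s hs1
  linarith

end Literature.Computability.AlgebraicComplexity

end
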